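import Literature.InformationTheory.QuantumCodes.AbelianTwoBlockParameters
import Literature.InformationTheory.QuantumCodes.StabilizerDistance
import Literature.InformationTheory.QuantumCodes.TwoSublatticeCSSFromStabilizer
import HarnessLib

/-!
# Kovalev–Pryadko 2013, Theorem 2: parameters of generalized-bicycle codes from the additive cyclic
# `𝔽₄`-code generated by `ωA + B` — `K = 2 deg p + 2 deg r − 2n` and `D ≥ d(𝒞^⊥)`

A. A. Kovalev, L. P. Pryadko, PRA 88 (2013) 012311 = arXiv:1212.6703 [KovalevPryadko2013Hyperbicycle],
§III.B "Generalized bicycle codes" (held text chunk p0007 L74–130), read on the page. With two commuting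
`n × n` binary matrices, `G_X = (A, B)`, `G_Z = (Bᵀ, Aᵀ)` (eq. (Bicycle-1)); for circulant `A = f₁(x)`,
`B = f₂(x)` "we map the linear combinations of rows in `G_X` to a classical length-`n` additive cyclic code
over `𝔽₄` … generated by `𝔾 = ωA + B`", and with the canonical two-generator form of Calderbank et al.
(Thm 14 of [CRSS98]) "`p(x) = gcd[f₁(x), xⁿ − 1]`, `r(x) = gcd[(xⁿ − 1) f₂(x)/p(x), xⁿ − 1]`":

> **Theorem 2.** The generalized bicycle codes in Eq. (Bicycle-1) have the block length `N = 2n`, the number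
> of encoded qubits `K = 2 deg p(x) + 2 deg r(x) − 2n` [`K = 2 deg p(x)` in the single generator case] and
> the distance exceeding or equal that of the classical code over `𝔽₄` formed by codewords orthogonal to `𝔾`
> with respect to the trace inner product.
> *Proof.* The code dimensionality immediately follows from the parameters of the canonical form of the code
> generated by `g(x)`. The orthogonal code contains the quantum code, hence the distance estimate. □
> "Note that the distance estimate in Theorem 2 is tight only for pure codes".

This file PROVES both clauses for the tree's GB code `AbelianTwoBlock.css a b` over `ℤ_n` (`Fin n`,
`H_X = [A|B]`, `H_Z = [Bᵀ|Aᵀ]`, `A = circulant a`, `B = circulant b`, `AbelianTwoBlockParameters.lean`):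

* **`GB.css_k_add_eq_kp13`** — `K + 2n = 2 (deg p + deg r)` with `p = gcd(f₁, xⁿ−1)`,
  `r = gcd((xⁿ−1) f₂ / p, xⁿ−1)` computed in `𝔽₂[x]` from the lifts `gbPoly a = f₁`, `gbPoly b = f₂`
  (no `ℕ`-subtraction). Route: the tree's Panteleev–Kalachev Prop. 1 `PanteleevKalachev2021_prop1_holds`
  (`rank H_X + deg g = n = rank H_Z + deg g`, `g = gcd(f₁, f₂, xⁿ−1)`, `AbelianTwoBlockCodes.lean`) gives
  `K = 2 deg g`, and the polynomial identity **`GB.natDegree_gcd_add_natDegree_gcd`**: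
  `deg p + deg r = n + deg g` (Bézout: `r ~ (xⁿ−1)/p · gcd(f₂, p)` and `gcd(f₂, p) ~ g`);
* **`GB.le_css_dZ_of_traceDual_pure`, `GB.le_css_dX_of_traceDual_pure`** — the distance clause: the
  trace-dual `𝒞^⊥` of the additive code generated by the rows `ω aᵢ + bᵢ` of `𝔾` is, in binary-pair
  (symplectic) form, `{(u|w) : A w + B u = 0}` (`GB.traceDual_iff`: symplectic orthogonality to every row
  `(A i | B i)`, `SymplecticCodes.sympInner`); every `Z`-logical `(u, w)` of the GB code (`A u + B w = 0`) is the
  non-zero pair `(w|u) ∈ 𝒞^⊥` of `𝔽₄`-weight `wgt_OR ≤ wt u + wt w`, so if `𝒞^⊥` has no non-zero word of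
  `𝔽₄`-weight `< d` ("pure to `d`", the tree's `IsPure` shape) then `d ≤ d_Z`, and `d ≤ d_X` (`d_X = d_Z`,
  `css_dX_eq_dZ`). Stated for `K > 0` (the tree's `d_Z` is the junk value `0` otherwise).

No named facts, no definitions, no instances. (The additive code itself is the row span `span{(A i | B i)}`
— `TwoSublattice.stab` of `TwoSublatticeCSSFromStabilizer.lean` — and `𝒞^⊥` its `sympDual`; the
hypotheses below are spelled out so that this file depends on neither.)

## References (locators read on the page)
* [KovalevPryadko2013Hyperbicycle] arXiv:1212.6703, §III.B eq. (Bicycle-1) and Thm 2 with proof (chunk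
  p0007 L74–130: generator `𝔾 = ωA + B`, canonical form `p(x)`, `r(x)`, "K = 2 deg p + 2 deg r − 2n",
  "the orthogonal code contains the quantum code, hence the distance estimate").
* [PanteleevKalachev2021] Quantum 5 (2021) 585 = arXiv:1904.02703, Prop. 1 (`k = 2 deg gcd(a, b, x^ℓ − 1)`;
  tree `PanteleevKalachev2021_prop1_holds`).
* [CalderbankEtAl1998] IEEE Trans. IT 44 (1998) 1369, §2 (trace/symplectic inner product of `(a|b)` pairs)
  and Thm 14 (canonical form of cyclic additive codes), as cited by KP13.
-/

namespace Literature.InformationTheory.QuantumCodes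

open Matrix Polynomial

namespace GB

variable {ℓ : ℕ}

/-! ### The distance clause: `D ≥ d(𝒞^⊥)` -/

/-- **The trace-dual code in symplectic form.** A pair `(u|w)` is trace-orthogonal to every generator row
`ω aᵢ + bᵢ` of `𝔾 = ωA + B` — symplectically orthogonal to every `(A i | B i)` — iff `A w + B u = 0`.
[cite: KovalevPryadko2013Hyperbicycle, Thm 2 (arXiv:1212.6703 chunk p0007 L113-116: "the classical code over F₄ formed by codewords orthogonal to 𝔾 with respect to the trace inner product")] [cite: CalderbankEtAl1998, §2 (inner product of (a|b) pairs)] -/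
theorem traceDual_iff [NeZero ℓ] (a b : Fin ℓ → ZMod 2) (x : SympVec ℓ) :
    (∀ i, sympInner ((circulant a i, circulant b i) : SympVec ℓ) x = 0) ↔
      circulant a *ᵥ x.2 + circulant b *ᵥ x.1 = 0 := by
  refine ⟨fun h => funext fun i => ?_, fun h i => ?_⟩
  · have := h i
    simp only [sympInner] at this
    simp only [Pi.add_apply, mulVec, Pi.zero_apply]
    rw [← this, dotProduct_comm x.1]
  · have := congrFun h i
    simp only [Pi.add_apply, mulVec, Pi.zero_apply] at this
    simp only [sympInner]
    rw [← this, dotProduct_comm (circulant b i)]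

/-- `wgt_OR(u|w) ≤ wt u + wt w`. [cite: CalderbankEtAl1998, §2 (weight of (a|b))] -/
private theorem sympWeight_le_add (x : SympVec ℓ) : sympWeight x ≤ hammingNorm x.1 + hammingNorm x.2 := by
  unfold sympWeight hammingNorm
  rw [Finset.filter_or]
  exact Finset.card_union_le _ _

/-- `|(u, w)| = |u| + |w|`. [folklore] -/
private theorem hammingNorm_sumElim' (u w : Fin ℓ → ZMod 2) :
    hammingNorm (Sum.elim u w) = hammingNorm u + hammingNorm w := by
  unfold hammingNorm
  rw [← Finset.card_disjSum]
  congr 1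
  ext i
  rcases i with i | i <;> simp [Finset.mem_disjSum]

/-- **Kovalev–Pryadko Thm 2, distance clause (`Z` side).** If the trace-dual `𝒞^⊥ = {(u|w) : A w + B u = 0}`
of the additive cyclic code of `𝔾 = ωA + B` has no non-zero word of `𝔽₄`-weight `< d`, then every
`Z`-logical of the GB code `(G_X, G_Z) = ([A|B], [Bᵀ|Aᵀ])` has weight `≥ d`: `d ≤ d_Z` ("the orthogonal code
contains the quantum code, hence the distance estimate"; tight only for pure codes). `K > 0` guards the
tree's junk value `d_Z = 0`. [cite: KovalevPryadko2013Hyperbicycle, Thm 2 and proof (arXiv:1212.6703 chunk p0007 L110-122)] -/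
theorem le_css_dZ_of_traceDual_pure [NeZero ℓ] (a b : Fin ℓ → ZMod 2) {d : ℕ}
    (hpure : ∀ x : SympVec ℓ, circulant a *ᵥ x.2 + circulant b *ᵥ x.1 = 0 → x ≠ 0 → d ≤ sympWeight x)
    (hk : 0 < (AbelianTwoBlock.css a b).k) : d ≤ (AbelianTwoBlock.css a b).dZ := by
  refine (AbelianTwoBlock.css a b).le_dZ (((AbelianTwoBlock.css a b).dZ_pos_iff).1
    ((AbelianTwoBlock.css a b).dZ_pos_of_k_pos hk)) fun v hv hv' => ?_
  -- `v = (u, w)` with `A u + B w = 0`, so `x = (w|u) ∈ 𝒞^⊥`, `x ≠ 0`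
  have hv0 : v ≠ 0 := by
    rintro rfl
    exact hv' (Submodule.zero_mem _)
  set x : SympVec ℓ := (v ∘ Sum.inr, v ∘ Sum.inl) with hxdef
  have hx : circulant a *ᵥ x.2 + circulant b *ᵥ x.1 = 0 := by
    rw [← Sum.elim_comp_inl_inr v, AbelianTwoBlock.css_HX, AbelianTwoBlock.HX_def, fromCols_mulVec_sumElim] at hv
    exact hv
  have hx0 : x ≠ 0 := by
    intro h0
    apply hv0
    rw [← Sum.elim_comp_inl_inr v]
    have h1 : v ∘ Sum.inr = 0 := congrArg Prod.fst h0
    have h2 : v ∘ Sum.inl = 0 := congrArg Prod.snd h0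
    rw [h1, h2]
    funext i; rcases i with i | i <;> rfl
  calc d ≤ sympWeight x := hpure x hx hx0
    _ ≤ hammingNorm (v ∘ Sum.inr) + hammingNorm (v ∘ Sum.inl) := sympWeight_le_add x
    _ = hammingNorm v := by
        conv_rhs => rw [← Sum.elim_comp_inl_inr v]
        rw [hammingNorm_sumElim', add_comm]

/-- **Kovalev–Pryadko Thm 2, distance clause (`X` side)** (`d_X = d_Z` for circulant two-block codes).
[cite: KovalevPryadko2013Hyperbicycle, Thm 2 and proof (arXiv:1212.6703 chunk p0007 L110-122)] -/
theorem le_css_dX_of_traceDual_pure [NeZero ℓ] (a b : Fin ℓ → ZMod 2) {d : ℕ}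
    (hpure : ∀ x : SympVec ℓ, circulant a *ᵥ x.2 + circulant b *ᵥ x.1 = 0 → x ≠ 0 → d ≤ sympWeight x)
    (hk : 0 < (AbelianTwoBlock.css a b).k) : d ≤ (AbelianTwoBlock.css a b).dX := by
  rw [AbelianTwoBlock.css_dX_eq_dZ]
  exact le_css_dZ_of_traceDual_pure a b hpure hk

/-! ### The dimension clause: `K = 2 deg p + 2 deg r − 2n` -/

/-- `K = 2 deg g`, `g = gcd(f₁, f₂, xⁿ − 1)` (the tree's Panteleev–Kalachev Prop. 1, in `CSSCode.k` form).
[cite: PanteleevKalachev2021, Prop. 1 (arXiv:1904.02703 §4.3)] [cite: KovalevPryadko2013Hyperbicycle, Thm 2 (arXiv:1212.6703 chunk p0007 L110-113)] -/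
theorem css_k_eq_two_mul_natDegree_gcd [NeZero ℓ] (a b : Fin ℓ → ZMod 2) :
    (AbelianTwoBlock.css a b).k =
      2 * (EuclideanDomain.gcd (EuclideanDomain.gcd (gbPoly a) (gbPoly b)) ((X : (ZMod 2)[X]) ^ ℓ - 1)).natDegree := by
  obtain ⟨hX, hZ⟩ := PanteleevKalachev2021_prop1_holds ℓ a b
  have hk := (AbelianTwoBlock.css a b).k_eq
  rw [AbelianTwoBlock.css_HX, AbelianTwoBlock.css_HZ, Fintype.card_sum, Fintype.card_fin] at hk
  omega

/-- `deg (xⁿ − 1) = n`. [folklore] -/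
private theorem natDegree_modulus [NeZero ℓ] : ((X : (ZMod 2)[X]) ^ ℓ - 1).natDegree = ℓ := by
  rw [← C_1]; exact natDegree_X_pow_sub_C

/-- `xⁿ − 1 ≠ 0`. [folklore] -/
private theorem modulus_ne_zero [NeZero ℓ] : ((X : (ZMod 2)[X]) ^ ℓ - 1) ≠ 0 := by
  intro h
  have := natDegree_modulus (ℓ := ℓ)
  rw [h, natDegree_zero] at this
  exact (NeZero.ne ℓ) this.symm

/-- Two polynomials dividing each other have the same degree. [folklore] -/
private theorem natDegree_eq_of_dvd_dvd {p q : (ZMod 2)[X]} (hp : p ≠ 0) (hq : q ≠ 0) (h1 : p ∣ q) (h2 : q ∣ p) :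
    p.natDegree = q.natDegree :=
  le_antisymm (natDegree_le_of_dvd h1 hq) (natDegree_le_of_dvd h2 hp)

/-- **The canonical-form degrees.** For `f₁, f₂ ∈ 𝔽₂[x]` and `m = xⁿ − 1`: with `p = gcd(f₁, m)`,
`r = gcd(m f₂ / p, m)` and `g = gcd(f₁, f₂, m)`, `deg p + deg r = n + deg g` — because `r` is associated with
`(m/p)·gcd(f₂, p)` (Bézout) and `gcd(f₂, p)` with `g`. This reconciles KP13's `K = 2 deg p + 2 deg r − 2n` with
Panteleev–Kalachev's `K = 2 deg g`. [cite: KovalevPryadko2013Hyperbicycle, §III.B (arXiv:1212.6703 chunk p0007 L100-107: canonical form, "k = 2n − deg p(x) − deg r(x)")] -/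
theorem natDegree_gcd_add_natDegree_gcd [NeZero ℓ] (f₁ f₂ : (ZMod 2)[X]) :
    (EuclideanDomain.gcd f₁ ((X : (ZMod 2)[X]) ^ ℓ - 1)).natDegree +
        (EuclideanDomain.gcd (((X : (ZMod 2)[X]) ^ ℓ - 1) * f₂ / EuclideanDomain.gcd f₁ ((X : (ZMod 2)[X]) ^ ℓ - 1))
          ((X : (ZMod 2)[X]) ^ ℓ - 1)).natDegree =
      ℓ + (EuclideanDomain.gcd (EuclideanDomain.gcd f₁ f₂) ((X : (ZMod 2)[X]) ^ ℓ - 1)).natDegree := by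
  set m : (ZMod 2)[X] := X ^ ℓ - 1 with hm
  have hm0 : m ≠ 0 := modulus_ne_zero
  set p := EuclideanDomain.gcd f₁ m with hp
  have hpm : p ∣ m := EuclideanDomain.gcd_dvd_right _ _
  have hpf : p ∣ f₁ := EuclideanDomain.gcd_dvd_left _ _
  have hp0 : p ≠ 0 := fun h => hm0 (by
    rw [hp] at h
    exact (EuclideanDomain.gcd_eq_zero_iff.1 h).2)
  -- `p' = m / p`, `p * p' = m`
  set p' := m / p with hp'
  have hpp' : p * p' = m := EuclideanDomain.mul_div_cancel' hp0 hpm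
  have hp'0 : p' ≠ 0 := fun h => hm0 (by rw [← hpp', h, mul_zero])
  have hdiv : m * f₂ / p = p' * f₂ := by
    rw [mul_comm m f₂, EuclideanDomain.mul_div_assoc _ hpm, mul_comm]
  rw [hdiv]
  set r := EuclideanDomain.gcd (p' * f₂) m with hr
  set q := EuclideanDomain.gcd f₂ p with hq
  set g := EuclideanDomain.gcd (EuclideanDomain.gcd f₁ f₂) m with hg
  have hq0 : q ≠ 0 := fun h => hp0 (by
    rw [hq] at h
    exact (EuclideanDomain.gcd_eq_zero_iff.1 h).2)
  have hg0 : g ≠ 0 := fun h => hm0 (by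
    rw [hg] at h
    exact (EuclideanDomain.gcd_eq_zero_iff.1 h).2)
  have hr0 : r ≠ 0 := fun h => hm0 (by
    rw [hr] at h
    exact (EuclideanDomain.gcd_eq_zero_iff.1 h).2)
  -- `r ~ p' * q`
  have h1 : r ∣ p' * q := by
    have hb : q = f₂ * EuclideanDomain.gcdA f₂ p + p * EuclideanDomain.gcdB f₂ p := EuclideanDomain.gcd_eq_gcd_ab _ _
    rw [hb, mul_add, ← mul_assoc, ← mul_assoc, mul_comm p' p, hpp']
    exact Dvd.dvd.add (dvd_mul_of_dvd_left (EuclideanDomain.gcd_dvd_left _ _) _)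
      (dvd_mul_of_dvd_left (EuclideanDomain.gcd_dvd_right _ _) _)
  have h2 : p' * q ∣ r := by
    refine EuclideanDomain.dvd_gcd (mul_dvd_mul_left p' (EuclideanDomain.gcd_dvd_left _ _)) ?_
    rw [← hpp', mul_comm p p']
    exact mul_dvd_mul_left p' (EuclideanDomain.gcd_dvd_right _ _)
  have hrdeg : r.natDegree = p'.natDegree + q.natDegree := by
    rw [natDegree_eq_of_dvd_dvd hr0 (mul_ne_zero hp'0 hq0) h1 h2, natDegree_mul hp'0 hq0]
  -- `q ~ g`
  have h3 : q ∣ g :=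
    EuclideanDomain.dvd_gcd (EuclideanDomain.dvd_gcd ((EuclideanDomain.gcd_dvd_right _ _).trans hpf)
      (EuclideanDomain.gcd_dvd_left _ _)) ((EuclideanDomain.gcd_dvd_right _ _).trans hpm)
  have h4 : g ∣ q := by
    have hg12 : g ∣ EuclideanDomain.gcd f₁ f₂ := EuclideanDomain.gcd_dvd_left _ _
    refine EuclideanDomain.dvd_gcd (hg12.trans (EuclideanDomain.gcd_dvd_right _ _))
      (EuclideanDomain.dvd_gcd (hg12.trans (EuclideanDomain.gcd_dvd_left _ _)) (EuclideanDomain.gcd_dvd_right _ _))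
  have hqdeg : q.natDegree = g.natDegree := natDegree_eq_of_dvd_dvd hq0 hg0 h3 h4
  -- `deg p + deg p' = n`
  have hpdeg : p.natDegree + p'.natDegree = ℓ := by
    rw [← natDegree_mul hp0 hp'0, hpp']
    exact natDegree_modulus
  omega

/-- **Kovalev–Pryadko 2013, Theorem 2 (dimension clause), as printed:** `K = 2 deg p(x) + 2 deg r(x) − 2n`
for the GB code of `f₁ = gbPoly a`, `f₂ = gbPoly b`, with `p = gcd[f₁, xⁿ − 1]`, `r = gcd[(xⁿ − 1) f₂ / p, xⁿ − 1]`
(canonical two-generator form of the additive cyclic code of `ωA + B`); typed as `K + 2n = 2 (deg p + deg r)`.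
[cite: KovalevPryadko2013Hyperbicycle, Thm 2 (arXiv:1212.6703 chunk p0007 L110-113: "the number of encoded qubits K = 2 deg p(x) + 2 deg r(x) − 2n")] -/
theorem css_k_add_eq_kp13 [NeZero ℓ] (a b : Fin ℓ → ZMod 2) :
    (AbelianTwoBlock.css a b).k + 2 * ℓ =
      2 * ((EuclideanDomain.gcd (gbPoly a) ((X : (ZMod 2)[X]) ^ ℓ - 1)).natDegree +
        (EuclideanDomain.gcd (((X : (ZMod 2)[X]) ^ ℓ - 1) * gbPoly b /
            EuclideanDomain.gcd (gbPoly a) ((X : (ZMod 2)[X]) ^ ℓ - 1)) ((X : (ZMod 2)[X]) ^ ℓ - 1)).natDegree) := by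
  rw [natDegree_gcd_add_natDegree_gcd, css_k_eq_two_mul_natDegree_gcd]
  ring

/-- **Single-generator case** `[K = 2 deg p(x)]`: with `f₂ = 0` (so `r = xⁿ − 1`), `K = 2 deg gcd(f₁, xⁿ − 1)`.
[cite: KovalevPryadko2013Hyperbicycle, Thm 2 (arXiv:1212.6703 chunk p0007 L111-112: "[K = 2 deg p(x) in the single generator case]")] -/
theorem css_k_eq_single_generator [NeZero ℓ] (a : Fin ℓ → ZMod 2) (b : Fin ℓ → ZMod 2) (hb : gbPoly b = 0) :
    (AbelianTwoBlock.css a b).k = 2 * (EuclideanDomain.gcd (gbPoly a) ((X : (ZMod 2)[X]) ^ ℓ - 1)).natDegree := by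
  rw [css_k_eq_two_mul_natDegree_gcd, hb, EuclideanDomain.gcd_zero_right]

/-! ### The same bound through the tree's additive-code vocabulary (appended 2026-08-27, qec-lit-3 g5)

With `TwoSublatticeCSSFromStabilizer.lean` in the tree, the additive cyclic code generated by the rows
`ω aᵢ + bᵢ` of `𝔾 = ωA + B` is `TwoSublattice.stab (circulant a) (circulant b)` and its trace-dual `𝒞^⊥` is
`sympDual` of it; "pure to `d`" is the tree's `IsPure`. -/

/-- `𝒞^⊥ = sympDual (stab A B)`: the explicit trace-dual condition `A w + B u = 0` is membership in the
symplectic dual of the row span of `(A|B)`. [cite: KovalevPryadko2013Hyperbicycle, Thm 2 (arXiv:1212.6703 chunk p0007 L113-116)] -/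
theorem mem_sympDual_stab_circulant_iff [NeZero ℓ] (a b : Fin ℓ → ZMod 2) (x : SympVec ℓ) :
    x ∈ sympDual (TwoSublattice.stab (circulant a) (circulant b)) ↔
      circulant a *ᵥ x.2 + circulant b *ᵥ x.1 = 0 :=
  TwoSublattice.mem_sympDual_stab_iff _ _ x

/-- **Kovalev–Pryadko Thm 2, distance clause, `IsPure` form:** if the additive code `S = rowspace(A|B)` of
`𝔾 = ωA + B` is pure to `d` (no non-zero word of `𝔽₄`-weight `< d` in `S⊥ = 𝒞^⊥`), then `d ≤ d_Z` and
`d ≤ d_X` for the GB code `([A|B], [Bᵀ|Aᵀ])` (`K > 0`).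
[cite: KovalevPryadko2013Hyperbicycle, Thm 2 and the remark after it (arXiv:1212.6703 chunk p0007 L110-122: "tight only for pure codes")] -/
theorem le_css_dZ_of_isPure [NeZero ℓ] (a b : Fin ℓ → ZMod 2) {d : ℕ}
    (hpure : IsPure (TwoSublattice.stab (circulant a) (circulant b)) d) (hk : 0 < (AbelianTwoBlock.css a b).k) :
    d ≤ (AbelianTwoBlock.css a b).dZ ∧ d ≤ (AbelianTwoBlock.css a b).dX := by
  have h : ∀ x : SympVec ℓ, circulant a *ᵥ x.2 + circulant b *ᵥ x.1 = 0 → x ≠ 0 → d ≤ sympWeight x :=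
    fun x hx hx0 => hpure x ((mem_sympDual_stab_circulant_iff a b x).2 hx) hx0
  exact ⟨le_css_dZ_of_traceDual_pure a b h hk, le_css_dX_of_traceDual_pure a b h hk⟩

end GB

end Literature.InformationTheory.QuantumCodes
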